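import Literature.NumberTheory.EllipticCurves.ZpExtensionGaloisTwistTateDualProofs
import Literature.NumberTheory.EllipticCurves.ZpExtensionGaloisTwistRestrict
import Literature.NumberTheory.EllipticCurves.WeilPairingTateDual
import Literature.NumberTheory.EllipticCurves.KummerSelmerStructure
import Literature.NumberTheory.GaloisRepresentations.LocalDualityDescent
import Literature.NumberTheory.GaloisRepresentations.LocalGlobalCohomologyFiniteProofs
import HarnessLib

/-!
# The twisted Weil duality `E[p^J](χ_{u'}) ⥲ E[p^J](χ_u)^D` (`u u' ≡ 1 mod p^J`) and the transport of
# `H¹(Γ_K, E[p^J](χ_u)^D)` to `H¹(Γ_K, E[p^J](χ_{u'}))` (definitions + theorems)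

Topic `NumberTheory/EllipticCurves` (next to `ZpExtensionGaloisTwistTateDualProofs`, `WeilPairingTateDual`);
namespace `WeierstrassCurve`. DEFINITIONS WITH BODIES + theorems; no named fact, no instance, no notation.

Greenberg (LNM 1716, §4 p. 123 «Then `T^* = T_p(E) ⊗ κ^{-s}`, `M^* = E[p^∞] ⊗ κ^{-s}`» — by the Weil pairing;
p. 124 «Note that `M^* = A_{-s}`»). At finite level: the Tate dual `Hom(E[p^J](χ_u), μ_{p^J})` of the twisted
torsion module is the OPPOSITE twist `E[p^J](χ_{u'})`, `u u' ≡ 1 (mod p^J)`. The tree already has the two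
halves — the Weil dual map `weilDualHom W n e … : E[n] → E[n]^D`, `T ↦ e(·, T)`, `Γ_K`-equivariant for an
equivariant pairing `e` (`WeilPairingTateDual`), and the equality of discrete Galois modules
`E[p^J](χ_u)^D = (E[p^J]^D)(χ_{u'})` (`ZpExtension.tateDual_galoisTwist`, file
`ZpExtensionGaloisTwistTateDualProofs`) — and this file assembles them:

* `W.twistedWeilDual p κ J hu hu' huu' e … : E[p^J](χ_{u'}) →ⁱL E[p^J](χ_u)^D` — the Weil dual map as a
  continuous `Γ_K`-intertwining map between the twisted modules (twisting an equivariant map by the same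
  character); `(twistedWeilDual T) S = e(S, T)`; injective for `e` non-degenerate and BIJECTIVE over a
  field of characteristic `0` (`#Hom(E[p^J], μ_{p^J}) = #E[p^J]`, tree `HomCarrier.natCard_eq`);
* `W.twistedWeilDualInv … : E[p^J](χ_u)^D →ⁱL E[p^J](χ_{u'})` — its inverse, with the two `apply` identities;
* **transport on `H¹`**: `H¹(w) ∘ H¹(w⁻¹) = id` and `H¹(w⁻¹) ∘ H¹(w) = id` on classes
  (`map_twistedWeilDual_map_inv`, `map_twistedWeilDualInv_map`), hence every class of
  `H¹(Γ_K, E[p^J](χ_u)^D)` — the currency of the dual Selmer group `H¹_{𝓕^*}` of the tree's Poitou–Tate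
  fact — is `H¹(w) y'` for a unique `y' ∈ H¹(Γ_K, E[p^J](χ_{u'}))` (`exists_unique_map_twistedWeilDual_eq`),
  and the same at every completion (`w` commutes with restriction, tree `galoisCohomology.res_map_one`).

This is brick (D1)/(α+) of the cell `bsd-2adic` design memo HOME/t42/DESIGN-T42-ADDENDUM-16/17 §A16.8: it lets
the dual-side control (δ) and the exponent bookkeeping (β1) of the twisted descent be carried out on classes
with values in `E[p^J]` (where the maps `twistedTorsionToH1` to `H¹(K_∞, E[p^∞])` and the Selmer group
`Sel_{p^∞}(E/K_∞)` live) instead of `Hom(E[p^J], μ)`. As in `WeilPairingTateDual`, the Weil pairing is an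
arbitrary biadditive `Γ_K`-equivariant `μ_{p^J}`-valued `e` on `E[p^J]` (the tree's
`WeierstrassCurve.exists_weilPairing` being existential). Not here: the compatibility of `w` with the change
of level `ι`/`π` (needs the descended pairing of `WeilPairingLevelDescent`), cup-product identities (generic:
`DiscreteGaloisModule.cupProduct_pairing_eq_tateDualPairing`).

References: R. Greenberg, LNM 1716 (1999), §4 pp. 123–124 [GreenbergLNM1716]; J. S. Milne, *Arithmetic
Duality Theorems* (2006), I §2, §6 proof of Prop. 6.9 [MilneADT2006]; J. H. Silverman, *AEC* (2009), III.8.1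
[SilvermanAEC2009].
-/

noncomputable section

open CategoryTheory Field
open scoped ContRepresentation

universe u

namespace WeierstrassCurve

open Literature.NumberTheory.EllipticCurves Literature.NumberTheory.GaloisRepresentations
open Literature.NumberTheory.GaloisRepresentations.DiscreteGaloisModule (TateDual tateDual MuCarrier)

variable {K : Type u} [Field K] (W : WeierstrassCurve K) [W.IsElliptic] (p : ℕ) [Fact p.Prime]
  (κ : ZpExtension K p) (J : ℕ) {u u' : ℤ} (hu : (p : ℤ) ∣ u - 1) (hu' : (p : ℤ) ∣ u' - 1)
  (huu' : ((p : ℤ) ^ J) ∣ u * u' - 1)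
  (e : W.geomTorsion ((p ^ J : ℕ) : ℤ) → W.geomTorsion ((p ^ J : ℕ) : ℤ) → AlgebraicClosure K)
  (hμ : ∀ S T, e S T ^ (p ^ J) = 1)
  (hadd₁ : ∀ S₁ S₂ T, e (S₁ + S₂) T = e S₁ T * e S₂ T)
  (hadd₂ : ∀ S T₁ T₂, e S (T₁ + T₂) = e S T₁ * e S T₂)
  (hgal : ∀ (σ : absoluteGaloisGroup K) (S T : W.geomTorsion ((p ^ J : ℕ) : ℤ)),
    σ • e S T = e (σ • S) (σ • T))
  [Finite (W.geomTorsion ((p ^ J : ℕ) : ℤ))]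

/-- `p^J ≠ 0` as a `NeZero` fact (for the tree's `weilDualHom W (p^J) …`). [cite: SilvermanAEC2009, Cor. III.6.4] -/
theorem neZero_prime_pow : NeZero (p ^ J) := ⟨pow_ne_zero _ (Fact.out : p.Prime).ne_zero⟩

/-! ## The twisted Weil dual map -/

/-- **The Weil dual map between the twisted modules, `w : E[p^J](χ_{u'}) →ⁱL E[p^J](χ_u)^D`** for
`u u' ≡ 1 (mod p^J)`: `T ↦ e(·, T)` (the tree's `weilDualHom`), `Γ_K`-equivariant because
`E[p^J](χ_u)^D = (E[p^J]^D)(χ_{u'})` (`ZpExtension.tateDual_galoisTwist`) and `weilDualHom` intertwines the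
untwisted actions (`weilDualHom_smul`). Greenberg's «`M^* = A_{-s}`» at finite level.
[cite: GreenbergLNM1716, §4 pp. 123–124] [cite: MilneADT2006, Ch. I §2, §6] -/
def twistedWeilDual :
    (W.twistedTorsionGaloisModule p κ J u' hu').toContRepresentation →ⁱL
      ((W.twistedTorsionGaloisModule p κ J u hu).tateDual (p ^ J)).toContRepresentation where
  toContinuousLinearMap :=
    haveI := neZero_prime_pow p J
    ⟨(weilDualHom W (p ^ J) e hμ hadd₁ hadd₂).toIntLinearMap, continuous_of_discreteTopology⟩
  isIntertwining' σ := by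
    haveI := neZero_prime_pow p J
    refine ContinuousLinearMap.ext fun T ↦ ?_
    change weilDualHom W (p ^ J) e hμ hadd₁ hadd₂ (W.twistedTorsionGaloisModule p κ J u' hu' σ T) =
      ((W.twistedTorsionGaloisModule p κ J u hu).tateDual (p ^ J)) σ
        (weilDualHom W (p ^ J) e hμ hadd₁ hadd₂ T)
    have hD : (W.twistedTorsionGaloisModule p κ J u hu).tateDual (p ^ J) =
        κ.galoisTwist ((W.torsionGaloisModule ((p ^ J : ℕ) : ℤ)).tateDual (p ^ J)) J
          (ZpExtension.pow_nsmul_tateDual_eq_zero (W.pow_nsmul_geomTorsion_pow p J) (p ^ J)) u' hu' :=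
      ZpExtension.tateDual_galoisTwist κ _ J _ hu hu' huu' (p ^ J)
    rw [hD, ZpExtension.galoisTwist_apply_apply, ZpExtension.galoisTwist_apply_apply,
      torsionGaloisModule_apply_apply, map_zsmul, weilDualHom_smul W (p ^ J) e hμ hadd₁ hadd₂ hgal σ T]

/-- Unfolding `w`: its underlying map is the Weil dual map `T ↦ e(·, T)`. [cite: MilneADT2006, Ch. I §6] -/
theorem twistedWeilDual_apply (T : W.geomTorsion ((p ^ J : ℕ) : ℤ)) :
    W.twistedWeilDual p κ J hu hu' huu' e hμ hadd₁ hadd₂ hgal T =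
      haveI := neZero_prime_pow p J; weilDualHom W (p ^ J) e hμ hadd₁ hadd₂ T := rfl

/-- Unfolding `w` on points: `(w T) S = e(S, T)` in `μ_{p^J}`. [cite: MilneADT2006, Ch. I §6] -/
theorem twistedWeilDual_apply_apply (T S : W.geomTorsion ((p ^ J : ℕ) : ℤ)) :
    W.twistedWeilDual p κ J hu hu' huu' e hμ hadd₁ hadd₂ hgal T S =
      haveI := neZero_prime_pow p J; weilPairingHom W (p ^ J) e hμ hadd₁ hadd₂ S T := rfl

/-- `w` is injective when `e` is non-degenerate on the right (Silverman III.8.1 (c); tree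
`weilDualHom_injective`). [cite: SilvermanAEC2009, Prop. III.8.1 (c)] -/
theorem twistedWeilDual_injective (hnondeg : ∀ T, (∀ S, e S T = 1) → T = 0) :
    Function.Injective (W.twistedWeilDual p κ J hu hu' huu' e hμ hadd₁ hadd₂ hgal) := by
  haveI := neZero_prime_pow p J
  exact weilDualHom_injective W (p ^ J) e hμ hadd₁ hadd₂ hnondeg

/-- **`w` is bijective** over a field of characteristic `0` for `e` non-degenerate: injective, and
`#Hom(E[p^J], μ_{p^J}) = #E[p^J]` (`HomCarrier.natCard_eq` with `μ_{p^J}(K̄) ≃ ℤ/p^J`, `muEquivZMod`).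
[cite: SilvermanAEC2009, Prop. III.8.1] [cite: MilneADT2006, Ch. I §0 (`M^DD = M`)] -/
theorem twistedWeilDual_bijective [CharZero K] (hnondeg : ∀ T, (∀ S, e S T = 1) → T = 0) :
    Function.Bijective (W.twistedWeilDual p κ J hu hu' huu' e hμ hadd₁ hadd₂ hgal) := by
  haveI := neZero_prime_pow p J
  haveI : Finite (TateDual K (W.geomTorsion ((p ^ J : ℕ) : ℤ)) (p ^ J)) :=
    DiscreteGaloisModule.TateDual.finite K (W.geomTorsion ((p ^ J : ℕ) : ℤ)) (p ^ J)
  exact (W.twistedWeilDual_injective p κ J hu hu' huu' e hμ hadd₁ hadd₂ hgal hnondeg).bijective_of_nat_card_le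
    (le_of_eq (HomCarrier.natCard_eq (M := W.geomTorsion ((p ^ J : ℕ) : ℤ)) (muEquivZMod K (p ^ J))
      (fun T ↦ AddSubgroup.torsionBy.nsmul T)))

/-! ## The inverse `w⁻¹ : E[p^J](χ_u)^D →ⁱL E[p^J](χ_{u'})` -/

section Inverse

variable [CharZero K] (hnondeg : ∀ T, (∀ S, e S T = 1) → T = 0)

/-- The inverse bijection of `w` as an additive equivalence. [cite: MilneADT2006, Ch. I §6] -/
def twistedWeilDualEquiv :
    W.geomTorsion ((p ^ J : ℕ) : ℤ) ≃+ TateDual K (W.geomTorsion ((p ^ J : ℕ) : ℤ)) (p ^ J) :=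
  AddEquiv.ofBijective (W.twistedWeilDual p κ J hu hu' huu' e hμ hadd₁ hadd₂ hgal).toLinearMap.toAddMonoidHom
    (W.twistedWeilDual_bijective p κ J hu hu' huu' e hμ hadd₁ hadd₂ hgal hnondeg)

/-- Unfolding `twistedWeilDualEquiv`: it is `w`. [cite: MilneADT2006, Ch. I §6] -/
@[simp] theorem twistedWeilDualEquiv_apply (T : W.geomTorsion ((p ^ J : ℕ) : ℤ)) :
    W.twistedWeilDualEquiv p κ J hu hu' huu' e hμ hadd₁ hadd₂ hgal hnondeg T =
      W.twistedWeilDual p κ J hu hu' huu' e hμ hadd₁ hadd₂ hgal T := rfl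

/-- **The inverse `w⁻¹ : E[p^J](χ_u)^D →ⁱL E[p^J](χ_{u'})`** as a continuous `Γ_K`-intertwining map
(equivariance transported from `w`). [cite: GreenbergLNM1716, §4 p. 124] [cite: MilneADT2006, Ch. I §6] -/
def twistedWeilDualInv :
    ((W.twistedTorsionGaloisModule p κ J u hu).tateDual (p ^ J)).toContRepresentation →ⁱL
      (W.twistedTorsionGaloisModule p κ J u' hu').toContRepresentation where
  toContinuousLinearMap :=
    ⟨(W.twistedWeilDualEquiv p κ J hu hu' huu' e hμ hadd₁ hadd₂ hgal hnondeg).symm.toIntLinearEquiv.toLinearMap,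
      continuous_of_discreteTopology⟩
  isIntertwining' σ := by
    refine ContinuousLinearMap.ext fun f ↦ ?_
    set E' := W.twistedWeilDualEquiv p κ J hu hu' huu' e hμ hadd₁ hadd₂ hgal hnondeg with hE'
    change E'.symm (((W.twistedTorsionGaloisModule p κ J u hu).tateDual (p ^ J)) σ f) =
      W.twistedTorsionGaloisModule p κ J u' hu' σ (E'.symm f)
    apply E'.injective
    rw [E'.apply_symm_apply]
    have h := congrArg (fun T ↦ T (E'.symm f))
      ((W.twistedWeilDual p κ J hu hu' huu' e hμ hadd₁ hadd₂ hgal).isIntertwining' σ)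
    change W.twistedWeilDual p κ J hu hu' huu' e hμ hadd₁ hadd₂ hgal
        (W.twistedTorsionGaloisModule p κ J u' hu' σ (E'.symm f)) =
      ((W.twistedTorsionGaloisModule p κ J u hu).tateDual (p ^ J)) σ
        (W.twistedWeilDual p κ J hu hu' huu' e hμ hadd₁ hadd₂ hgal (E'.symm f)) at h
    have h2 : W.twistedWeilDual p κ J hu hu' huu' e hμ hadd₁ hadd₂ hgal (E'.symm f) = f :=
      E'.apply_symm_apply f
    rw [h2] at h
    exact h.symm

/-- `w (w⁻¹ f) = f`. [cite: MilneADT2006, Ch. I §6] -/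
@[simp] theorem twistedWeilDual_inv_apply (f : TateDual K (W.geomTorsion ((p ^ J : ℕ) : ℤ)) (p ^ J)) :
    W.twistedWeilDual p κ J hu hu' huu' e hμ hadd₁ hadd₂ hgal
        (W.twistedWeilDualInv p κ J hu hu' huu' e hμ hadd₁ hadd₂ hgal hnondeg f) = f :=
  (W.twistedWeilDualEquiv p κ J hu hu' huu' e hμ hadd₁ hadd₂ hgal hnondeg).apply_symm_apply f

/-- `w⁻¹ (w T) = T`. [cite: MilneADT2006, Ch. I §6] -/
@[simp] theorem twistedWeilDualInv_apply (T : W.geomTorsion ((p ^ J : ℕ) : ℤ)) :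
    W.twistedWeilDualInv p κ J hu hu' huu' e hμ hadd₁ hadd₂ hgal hnondeg
        (W.twistedWeilDual p κ J hu hu' huu' e hμ hadd₁ hadd₂ hgal T) = T :=
  (W.twistedWeilDualEquiv p κ J hu hu' huu' e hμ hadd₁ hadd₂ hgal hnondeg).symm_apply_apply T

/-! ## Transport on `H¹` -/

/-- **`H¹(w) (H¹(w⁻¹) y) = y`** on `H¹(Γ_K, E[p^J](χ_u)^D)` (functoriality of `H¹` on explicit cocycles).
[cite: SerreGaloisCohomology1997, I §2.2] -/
theorem map_twistedWeilDual_map_inv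
    (y : galoisCohomology ((W.twistedTorsionGaloisModule p κ J u hu).tateDual (p ^ J)) 1) :
    galoisCohomology.map (W.twistedWeilDual p κ J hu hu' huu' e hμ hadd₁ hadd₂ hgal) 1
        (galoisCohomology.map (W.twistedWeilDualInv p κ J hu hu' huu' e hμ hadd₁ hadd₂ hgal hnondeg) 1 y) =
      y := by
  obtain ⟨ξ, rfl⟩ := oneCocycleClass_surjective _ y
  rw [galoisCohomology.map_one_oneCocycleClass, galoisCohomology.map_one_oneCocycleClass]
  exact congrArg _ (Subtype.ext (ContinuousMap.ext fun g ↦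
    W.twistedWeilDual_inv_apply p κ J hu hu' huu' e hμ hadd₁ hadd₂ hgal hnondeg (ξ.1 g)))

/-- **`H¹(w⁻¹) (H¹(w) y') = y'`** on `H¹(Γ_K, E[p^J](χ_{u'}))`. [cite: SerreGaloisCohomology1997, I §2.2] -/
theorem map_twistedWeilDualInv_map
    (y' : galoisCohomology (W.twistedTorsionGaloisModule p κ J u' hu') 1) :
    galoisCohomology.map (W.twistedWeilDualInv p κ J hu hu' huu' e hμ hadd₁ hadd₂ hgal hnondeg) 1
        (galoisCohomology.map (W.twistedWeilDual p κ J hu hu' huu' e hμ hadd₁ hadd₂ hgal) 1 y') = y' := by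
  obtain ⟨ξ, rfl⟩ := oneCocycleClass_surjective _ y'
  rw [galoisCohomology.map_one_oneCocycleClass, galoisCohomology.map_one_oneCocycleClass]
  exact congrArg _ (Subtype.ext (ContinuousMap.ext fun g ↦
    W.twistedWeilDualInv_apply p κ J hu hu' huu' e hμ hadd₁ hadd₂ hgal hnondeg (ξ.1 g)))

include hnondeg in
/-- **Every class of `H¹(Γ_K, E[p^J](χ_u)^D)` is `H¹(w) y'` for a unique `y' ∈ H¹(Γ_K, E[p^J](χ_{u'}))`** —
the dual Selmer classes of the Poitou–Tate obstruction read as twisted torsion classes (Greenberg's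
«`S_{M^*}(F) = S_{A_{-s}}(F)`», p. 124). [cite: GreenbergLNM1716, §4 pp. 123–124] -/
theorem exists_unique_map_twistedWeilDual_eq
    (y : galoisCohomology ((W.twistedTorsionGaloisModule p κ J u hu).tateDual (p ^ J)) 1) :
    ∃! y' : galoisCohomology (W.twistedTorsionGaloisModule p κ J u' hu') 1,
      galoisCohomology.map (W.twistedWeilDual p κ J hu hu' huu' e hμ hadd₁ hadd₂ hgal) 1 y' = y := by
  refine ⟨galoisCohomology.map (W.twistedWeilDualInv p κ J hu hu' huu' e hμ hadd₁ hadd₂ hgal hnondeg) 1 y,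
    W.map_twistedWeilDual_map_inv p κ J hu hu' huu' e hμ hadd₁ hadd₂ hgal hnondeg y, fun y' hy' ↦ ?_⟩
  rw [← hy', map_twistedWeilDualInv_map]

include hnondeg in
/-- `H¹(w)` is injective. [cite: SerreGaloisCohomology1997, I §2.2] -/
theorem map_twistedWeilDual_injective :
    Function.Injective
      (galoisCohomology.map (W.twistedWeilDual p κ J hu hu' huu' e hμ hadd₁ hadd₂ hgal) 1) := by
  intro a b h
  have := congrArg
    (galoisCohomology.map (W.twistedWeilDualInv p κ J hu hu' huu' e hμ hadd₁ hadd₂ hgal hnondeg) 1) h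
  rwa [map_twistedWeilDualInv_map, map_twistedWeilDualInv_map] at this

include hnondeg in
/-- **At a completion `E`: every local class of `H¹(Γ_E, E[p^J](χ_u)^D|_E)` is `H¹(w|_E) t'` for a unique
local class `t'` of `E[p^J](χ_{u'})|_E`** (same argument for the restricted maps). [cite: SerreGaloisCohomology1997, I §2.4] -/
theorem exists_unique_map_twistedWeilDual_restrictField_eq (E : Type u) [Field E] [Algebra K E]
    (y : galoisCohomology (((W.twistedTorsionGaloisModule p κ J u hu).tateDual (p ^ J)).restrictField E) 1) :
    ∃! t' : galoisCohomology ((W.twistedTorsionGaloisModule p κ J u' hu').restrictField E) 1,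
      galoisCohomology.map
        ((W.twistedWeilDual p κ J hu hu' huu' e hμ hadd₁ hadd₂ hgal).restrictField E) 1 t' = y := by
  have h1 : ∀ z, galoisCohomology.map
      ((W.twistedWeilDual p κ J hu hu' huu' e hμ hadd₁ hadd₂ hgal).restrictField E) 1
      (galoisCohomology.map
        ((W.twistedWeilDualInv p κ J hu hu' huu' e hμ hadd₁ hadd₂ hgal hnondeg).restrictField E) 1 z) =
      z := fun z ↦ by
    obtain ⟨ξ, rfl⟩ := oneCocycleClass_surjective _ z
    rw [galoisCohomology.map_one_oneCocycleClass, galoisCohomology.map_one_oneCocycleClass]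
    exact congrArg _ (Subtype.ext (ContinuousMap.ext fun g ↦
      W.twistedWeilDual_inv_apply p κ J hu hu' huu' e hμ hadd₁ hadd₂ hgal hnondeg (ξ.1 g)))
  have h2 : ∀ z, galoisCohomology.map
      ((W.twistedWeilDualInv p κ J hu hu' huu' e hμ hadd₁ hadd₂ hgal hnondeg).restrictField E) 1
      (galoisCohomology.map
        ((W.twistedWeilDual p κ J hu hu' huu' e hμ hadd₁ hadd₂ hgal).restrictField E) 1 z) = z := fun z ↦ by
    obtain ⟨ξ, rfl⟩ := oneCocycleClass_surjective _ z
    rw [galoisCohomology.map_one_oneCocycleClass, galoisCohomology.map_one_oneCocycleClass]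
    exact congrArg _ (Subtype.ext (ContinuousMap.ext fun g ↦
      W.twistedWeilDualInv_apply p κ J hu hu' huu' e hμ hadd₁ hadd₂ hgal hnondeg (ξ.1 g)))
  refine ⟨_, h1 y, fun t' ht' ↦ ?_⟩
  rw [← ht', h2]

omit [CharZero K] in
/-- `H¹(w)` commutes with restriction to a completion (the tree's `res_map_one`).
[cite: SerreGaloisCohomology1997, I §2.4] -/
theorem res_map_twistedWeilDual (E : Type u) [Field E] [Algebra K E]
    (y' : galoisCohomology (W.twistedTorsionGaloisModule p κ J u' hu') 1) :
    galoisCohomology.res ((W.twistedTorsionGaloisModule p κ J u hu).tateDual (p ^ J)) E 1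
        (galoisCohomology.map (W.twistedWeilDual p κ J hu hu' huu' e hμ hadd₁ hadd₂ hgal) 1 y') =
      galoisCohomology.map ((W.twistedWeilDual p κ J hu hu' huu' e hμ hadd₁ hadd₂ hgal).restrictField E) 1
        (galoisCohomology.res (W.twistedTorsionGaloisModule p κ J u' hu') E 1 y') :=
  galoisCohomology.res_map_one E _ y'

end Inverse

end WeierstrassCurve

end
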